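import Literature.Analysis.FluidPDE.PassiveVectorTensorDistortedConstFrameUniqueness
import Literature.Analysis.FluidPDE.PassiveVectorSuperposition
import HarnessLib

/-!
# Superposition for the CONSTANT-FRAME distorted weak passive-vector class: sums, constant multiples, finite sums

Analysis/FluidPDE proof-support file (everything proved; no new definitions, no named facts).

The distorted weak class `Torus.IsWeakTensorPassiveVectorDistortedOn A T 𝔸 b G w₀ w` (`PassiveVectorTensorDistorted` §5)
is LINEAR in the pair (datum, solution) as soon as every space–time weak integrand is integrable; for a CONSTANT frame
`G = fun _ _ => G₀` (Armstrong–Vicol's Lagrangian-coordinate ansatz with the distortion frozen, arXiv:2305.05048 §4.1)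
the coefficient field `y ↦ 𝔸^{G₀}` has trivially `C¹` slices, so `…DistortedDuality.integrable_weakIntegrand_lipschitzField`
applies to every time-Lipschitz space-smooth test, exactly as in `…ConstFrameUniqueness.sub_of_eq_constFrame` (equal data).
This file is the general-data twin of `PassiveVectorTensorSuperposition` for the constant frame:
* bookkeeping closed under sums for ANY frame: `lintegral_mul_add_lt_top_dist`, `ae_lintegral_sq_add_le_dist`;
* constant-frame linear algebra of the constraint: `distort_const_add'`, `distort_const_smul'`, `integrable_distort_const'`;
* **`add_constFrame`**, **`const_smul_constFrame`**, `neg_constFrame`, `sub_constFrame`, **`finset_sum_constFrame`**.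
Step B2 of the port plan `HOME/ad-sawtooth-k1loc-p1/g16/W7thg-portplan-k1locp1g16.md` (cell `ad-ideate`, K1L_D
stmt-AnomalousDissipation-27980; with B1 `…ConstFrameTranslate` and uniqueness it gives the Bloch-sector invariance B3).

## Mathlib / tree search

Tree: `PassiveVectorTensorSuperposition` (flat `add`/`const_smul`/`finset_sum`/`neg`/`sub`), `PassiveVectorSuperposition`
(`IsWeaklyDivFree.add_of_integrable`, `.const_smul'`), `PassiveVectorTensorDistortedConstFrameUniqueness` (`sub_of_eq_constFrame`,
private constant-frame helpers re-proved here), `PassiveVectorTensorDistortedDuality` (`integrable_weakIntegrand_lipschitzField`),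
the kinematic API of the distorted class (`aestronglyMeasurable_uncurry(_carrier)`, `exists_eLpNorm_le`, `ae_memLp_two`).
`rg "add_constFrame|finset_sum" Literature/Analysis/FluidPDE/PassiveVectorTensorDistorted*.lean`: nothing (2026-08-29).

## References

* S. Armstrong, V. Vicol, *Anomalous diffusion by fractal homogenization*, Ann. PDE 11 (2025) / arXiv:2305.05048, §4.1, PDF p. 34. [`ArmstrongVicol2025`]
* R. J. DiPerna, P.-L. Lions, Invent. Math. 98 (1989) 511–547, §II.1 (12)–(14). [`DiPernaLions1989`]
* R. Temam, *Navier–Stokes Equations* (1984), Ch. I §1.4 (the space `H`). [`Temam1984`]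
-/

noncomputable section

open MeasureTheory TopologicalSpace Set Function Filter Topology UnitAddTorus
open scoped ENNReal NNReal InnerProductSpace

namespace Literature.Analysis.FluidPDE

namespace Torus

variable {d : Type*} [Fintype d] [DecidableEq d]

/-! ## §1 Constant-frame linear algebra of the constraint -/

omit [DecidableEq d] in
/-- A constant distortion is additive: `G₀(u₁ + u₂) = G₀u₁ + G₀u₂` pointwise. [cite: ArmstrongVicol2025, §4.1 (PDF p. 34)] -/
theorem distort_const_add' (G₀ : Matrix d d ℝ) (u₁ u₂ : UnitAddTorus d → EuclideanSpace ℝ d) :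
    distort (fun _ : UnitAddTorus d => G₀) (fun x => u₁ x + u₂ x) =
      fun x => distort (fun _ : UnitAddTorus d => G₀) u₁ x + distort (fun _ : UnitAddTorus d => G₀) u₂ x := by
  funext y
  ext a
  rw [distort_apply]
  simp only [PiLp.add_apply, distort_apply, mul_add, Finset.sum_add_distrib]

omit [DecidableEq d] in
/-- A constant distortion is homogeneous: `G₀(c•u) = c•G₀u` pointwise. [cite: ArmstrongVicol2025, §4.1 (PDF p. 34)] -/
theorem distort_const_smul' (G₀ : Matrix d d ℝ) (c : ℝ) (u : UnitAddTorus d → EuclideanSpace ℝ d) :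
    distort (fun _ : UnitAddTorus d => G₀) (fun x => c • u x) = fun x => c • distort (fun _ : UnitAddTorus d => G₀) u x := by
  funext y
  ext a
  rw [distort_apply]
  simp only [PiLp.smul_apply, smul_eq_mul, distort_apply, Finset.mul_sum]
  exact Finset.sum_congr rfl fun b _ => by ring

/-- A constant distortion of an integrable field is integrable (a constant linear map of the fibre). [cite: ArmstrongVicol2025, §4.1 (PDF p. 34)] -/
theorem integrable_distort_const' (G₀ : Matrix d d ℝ) {v : UnitAddTorus d → EuclideanSpace ℝ d}
    (hv : Integrable v volume) : Integrable (distort (fun _ : UnitAddTorus d => G₀) v) volume := by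
  have e : distort (fun (_ : UnitAddTorus d) => G₀) v =
      fun x => (Matrix.toEuclideanCLM (n := d) (𝕜 := ℝ) G₀) (v x) := by
    funext x
    ext a
    rw [distort_apply, show Matrix.toEuclideanCLM (n := d) (𝕜 := ℝ) G₀ (v x) a =
      WithLp.ofLp (Matrix.toEuclideanCLM (n := d) (𝕜 := ℝ) G₀ (v x)) a from rfl, Matrix.ofLp_toEuclideanCLM]
    simp [Matrix.mulVec, dotProduct]
  rw [e]
  exact ContinuousLinearMap.integrable_comp _ hv

omit [Fintype d] in
/-- Partial derivatives of constants vanish. [folklore] -/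
private theorem partialDeriv_const_scalar (c : ℝ) (l : d) (x : UnitAddTorus d) :
    FunctionSpaces.Torus.partialDeriv l (fun _ : UnitAddTorus d => c) x = 0 := by
  simp [FunctionSpaces.Torus.partialDeriv, FunctionSpaces.Torus.lineDeriv]

/-! ## §2 Bookkeeping closed under sums (any frame) -/

namespace IsWeakTensorPassiveVectorDistortedOn

variable {A T : ℝ} {𝔸 : Visc4 d} {b u v : ℝ → UnitAddTorus d → EuclideanSpace ℝ d}
  {G : ℝ → UnitAddTorus d → Matrix d d ℝ} {G₀ : Matrix d d ℝ} {u₀ v₀ : UnitAddTorus d → EuclideanSpace ℝ d}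

/-- `∫₀ᵀ∫ |b|·|u + v| < ∞` for two members of the class with the same carrier. [cite: DiPernaLions1989, §II.1 (12)–(14)] -/
theorem lintegral_mul_add_lt_top_dist (h₁ : IsWeakTensorPassiveVectorDistortedOn A T 𝔸 b G u₀ u)
    (h₂ : IsWeakTensorPassiveVectorDistortedOn A T 𝔸 b G v₀ v) :
    ∫⁻ t in Ioo 0 T, ∫⁻ x, ‖b t x‖ₑ * ‖u t x + v t x‖ₑ < ⊤ := by
  set μT : Measure ℝ := (volume : Measure ℝ).restrict (Ioo 0 T) with hμT
  have hmu := h₁.aestronglyMeasurable_uncurry_carrier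
  have hm₁ := h₁.aestronglyMeasurable_uncurry
  have hm₂ := h₂.aestronglyMeasurable_uncurry
  have hF : AEMeasurable (fun p : ℝ × UnitAddTorus d => ‖b p.1 p.2‖ₑ * ‖u p.1 p.2 + v p.1 p.2‖ₑ)
      (μT.prod volume) := hmu.enorm.mul (hm₁.add hm₂).enorm
  have hF₁ : AEMeasurable (fun p : ℝ × UnitAddTorus d => ‖b p.1 p.2‖ₑ * ‖u p.1 p.2‖ₑ) (μT.prod volume) :=
    hmu.enorm.mul hm₁.enorm
  have hF₂ : AEMeasurable (fun p : ℝ × UnitAddTorus d => ‖b p.1 p.2‖ₑ * ‖v p.1 p.2‖ₑ) (μT.prod volume) :=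
    hmu.enorm.mul hm₂.enorm
  have e : ∫⁻ t in Ioo 0 T, ∫⁻ x, ‖b t x‖ₑ * ‖u t x + v t x‖ₑ =
      ∫⁻ p, ‖b p.1 p.2‖ₑ * ‖u p.1 p.2 + v p.1 p.2‖ₑ ∂(μT.prod volume) := (lintegral_prod _ hF).symm
  rw [e]
  calc ∫⁻ p, ‖b p.1 p.2‖ₑ * ‖u p.1 p.2 + v p.1 p.2‖ₑ ∂(μT.prod volume)
      ≤ ∫⁻ p, (‖b p.1 p.2‖ₑ * ‖u p.1 p.2‖ₑ + ‖b p.1 p.2‖ₑ * ‖v p.1 p.2‖ₑ) ∂(μT.prod volume) := by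
        refine lintegral_mono fun p => ?_
        rw [← mul_add]
        gcongr
        exact enorm_add_le _ _
    _ = (∫⁻ p, ‖b p.1 p.2‖ₑ * ‖u p.1 p.2‖ₑ ∂(μT.prod volume)) +
          ∫⁻ p, ‖b p.1 p.2‖ₑ * ‖v p.1 p.2‖ₑ ∂(μT.prod volume) := lintegral_add_left' hF₁ _
    _ = (∫⁻ t in Ioo 0 T, ∫⁻ x, ‖b t x‖ₑ * ‖u t x‖ₑ) + ∫⁻ t in Ioo 0 T, ∫⁻ x, ‖b t x‖ₑ * ‖v t x‖ₑ := by
        rw [lintegral_prod _ hF₁, lintegral_prod _ hF₂]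
    _ < ⊤ := ENNReal.add_lt_top.2 ⟨h₁.lintegral_mul_lt_top, h₂.lintegral_mul_lt_top⟩

/-- `u + v ∈ L^∞(0,T; L²)`. [cite: DiPernaLions1989, §II.1 (12)–(14)] -/
theorem ae_lintegral_sq_add_le_dist (h₁ : IsWeakTensorPassiveVectorDistortedOn A T 𝔸 b G u₀ u)
    (h₂ : IsWeakTensorPassiveVectorDistortedOn A T 𝔸 b G v₀ v) :
    ∃ C : ℝ≥0, ∀ᵐ t ∂(volume.restrict (Ioo 0 T)), ∫⁻ x, ‖u t x + v t x‖ₑ ^ 2 ≤ C := by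
  obtain ⟨C₁, hC₁⟩ := h₁.exists_eLpNorm_le
  obtain ⟨C₂, hC₂⟩ := h₂.exists_eLpNorm_le
  refine ⟨(C₁ + C₂) ^ 2, ?_⟩
  filter_upwards [hC₁, hC₂, h₁.ae_memLp_two, h₂.ae_memLp_two] with t hc₁ hc₂ hm₁ hm₂
  have hadd : eLpNorm (u t + v t) 2 volume ≤ C₁ + C₂ :=
    (eLpNorm_add_le hm₁.1 hm₂.1 one_le_two).trans (add_le_add hc₁ hc₂)
  have e : ∫⁻ x, ‖u t x + v t x‖ₑ ^ 2 = eLpNorm (u t + v t) 2 volume ^ 2 := by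
    rw [eLpNorm_eq_lintegral_rpow_enorm_toReal two_ne_zero ENNReal.ofNat_ne_top, ENNReal.toReal_ofNat,
      ← ENNReal.rpow_natCast, ← ENNReal.rpow_mul]
    norm_num
  rw [e, ENNReal.coe_pow, ENNReal.coe_add]
  exact pow_le_pow_left' hadd 2

/-- The space–time weak integrand of a CONSTANT-frame member against a time-Lipschitz space-smooth test is integrable
(`integrable_weakIntegrand_lipschitzField` with the trivially `C¹` constant coefficient field). [cite: DiPernaLions1989, §II.1 (12)–(14)] -/
theorem integrable_weakIntegrand_constFrame (h : IsWeakTensorPassiveVectorDistortedOn A T 𝔸 b (fun _ _ => G₀) u₀ u)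
    {Ψ : ℝ → UnitAddTorus d → EuclideanSpace ℝ d} (hΨ : IsLipschitzSpaceTimeTest T Ψ) :
    Integrable (fun p : ℝ × UnitAddTorus d =>
      ⟪u p.1 p.2, FunctionSpaces.Torus.timeDeriv Ψ p.1 p.2 + FunctionSpaces.Torus.convect (b p.1) (Ψ p.1) p.2 +
          viscAdjVar (fun y => Visc4.conj ((fun (_ : ℝ) (_ : UnitAddTorus d) => G₀) p.1 y) 𝔸) (Ψ p.1) p.2⟫_ℝ +
        A * ⟪b p.1 p.2, FunctionSpaces.Torus.convect (u p.1) (Ψ p.1) p.2⟫_ℝ)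
      (((volume : Measure ℝ).restrict (Ioo 0 T)).prod volume) := by
  have hG1 : ∀ (t : ℝ) (i j : d), FunctionSpaces.Torus.IsContDiff 1
      (fun y : UnitAddTorus d => (fun (_ : ℝ) (_ : UnitAddTorus d) => G₀) t y i j) :=
    fun _ i j => FunctionSpaces.Torus.isContDiff_const (G₀ i j)
  have hGc : ∀ i j : d, Continuous (uncurry fun (t : ℝ) (y : UnitAddTorus d) =>
      (fun (_ : ℝ) (_ : UnitAddTorus d) => G₀) t y i j) := fun _ _ => continuous_const
  have hGd : ∀ (i j e' : d), Continuous (uncurry fun (t : ℝ) (y : UnitAddTorus d) =>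
      FunctionSpaces.Torus.partialDeriv e' (fun y => (fun (_ : ℝ) (_ : UnitAddTorus d) => G₀) t y i j) y) := by
    intro i j e'
    have e : (uncurry fun (t : ℝ) (y : UnitAddTorus d) =>
        FunctionSpaces.Torus.partialDeriv e' (fun y => (fun (_ : ℝ) (_ : UnitAddTorus d) => G₀) t y i j) y) =
        fun _ => (0 : ℝ) := by
      funext p
      simp only [uncurry]
      exact partialDeriv_const_scalar (G₀ i j) e' p.2
    rw [e]
    exact continuous_const
  exact h.integrable_weakIntegrand_lipschitzField (ψ := Ψ) hΨ.isSmooth_slice hΨ.continuous_uncurry_iterPartialDeriv hΨ.lipschitz hG1 hGc hGd 𝔸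

/-! ## §3 Superposition at a constant frame -/

/-- **Superposition (additivity) of constant-frame distorted weak solutions**: `u + v` solves from `u₀ + v₀` (same carrier, coupling,
tensor, constant frame; integrable data to split the datum pairing). [cite: DiPernaLions1989, §II.1 (12)–(14)] [cite: ArmstrongVicol2025, §4.1 (PDF p. 34)] -/
theorem add_constFrame (h₁ : IsWeakTensorPassiveVectorDistortedOn A T 𝔸 b (fun _ _ => G₀) u₀ u)
    (h₂ : IsWeakTensorPassiveVectorDistortedOn A T 𝔸 b (fun _ _ => G₀) v₀ v)
    (hu₀ : Integrable u₀ volume) (hv₀ : Integrable v₀ volume) :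
    IsWeakTensorPassiveVectorDistortedOn A T 𝔸 b (fun _ _ => G₀) (fun x => u₀ x + v₀ x) (fun t x => u t x + v t x) where
  aestronglyMeasurable := h₁.aestronglyMeasurable.add h₂.aestronglyMeasurable
  aestronglyMeasurable_carrier := h₁.aestronglyMeasurable_carrier
  ae_lintegral_sq_le := ae_lintegral_sq_add_le_dist h₁ h₂
  lintegral_carrier_lt_top := h₁.lintegral_carrier_lt_top
  lintegral_mul_lt_top := lintegral_mul_add_lt_top_dist h₁ h₂
  ae_isWeaklyDivFree_carrier := h₁.ae_isWeaklyDivFree_carrier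
  ae_isWeaklyDivFree_distort := by
    filter_upwards [h₁.ae_isWeaklyDivFree_distort, h₂.ae_isWeaklyDivFree_distort, h₁.ae_memLp_two, h₂.ae_memLp_two]
      with t hd₁ hd₂ hm₁ hm₂
    have e : distort ((fun (_ : ℝ) (_ : UnitAddTorus d) => G₀) t) (fun x => u t x + v t x) =
        fun x => distort (fun _ : UnitAddTorus d => G₀) (u t) x + distort (fun _ : UnitAddTorus d => G₀) (v t) x :=
      distort_const_add' G₀ (u t) (v t)
    rw [e]
    exact hd₁.add_of_integrable hd₂ (integrable_distort_const' G₀ (hm₁.integrable one_le_two))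
      (integrable_distort_const' G₀ (hm₂.integrable one_le_two))
  weak_eq Ψ hΨ hΨdiv := by
    have e₁ := h₁.weak_eq Ψ hΨ hΨdiv
    have e₂ := h₂.weak_eq Ψ hΨ hΨdiv
    have hI₁ := integrable_weakIntegrand_constFrame h₁ hΨ
    have hI₂ := integrable_weakIntegrand_constFrame h₂ hΨ
    have hpt : ∀ t x, ⟪u t x + v t x, FunctionSpaces.Torus.timeDeriv Ψ t x +
          FunctionSpaces.Torus.convect (b t) (Ψ t) x +
          viscAdjVar (fun y => Visc4.conj ((fun (_ : ℝ) (_ : UnitAddTorus d) => G₀) t y) 𝔸) (Ψ t) x⟫_ℝ +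
        A * ⟪b t x, FunctionSpaces.Torus.convect (fun y => u t y + v t y) (Ψ t) x⟫_ℝ =
        (⟪u t x, FunctionSpaces.Torus.timeDeriv Ψ t x +
            FunctionSpaces.Torus.convect (b t) (Ψ t) x +
            viscAdjVar (fun y => Visc4.conj ((fun (_ : ℝ) (_ : UnitAddTorus d) => G₀) t y) 𝔸) (Ψ t) x⟫_ℝ +
          A * ⟪b t x, FunctionSpaces.Torus.convect (u t) (Ψ t) x⟫_ℝ) +
        (⟪v t x, FunctionSpaces.Torus.timeDeriv Ψ t x +
            FunctionSpaces.Torus.convect (b t) (Ψ t) x +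
            viscAdjVar (fun y => Visc4.conj ((fun (_ : ℝ) (_ : UnitAddTorus d) => G₀) t y) 𝔸) (Ψ t) x⟫_ℝ +
          A * ⟪b t x, FunctionSpaces.Torus.convect (v t) (Ψ t) x⟫_ℝ) := by
      intro t x
      simp only [FunctionSpaces.Torus.convect, map_add, inner_add_left, inner_add_right]
      ring
    have hslice : ∀ᵐ t ∂(volume.restrict (Ioo 0 T)),
        ∫ x, (⟪u t x + v t x, FunctionSpaces.Torus.timeDeriv Ψ t x +
            FunctionSpaces.Torus.convect (b t) (Ψ t) x +
            viscAdjVar (fun y => Visc4.conj ((fun (_ : ℝ) (_ : UnitAddTorus d) => G₀) t y) 𝔸) (Ψ t) x⟫_ℝ +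
          A * ⟪b t x, FunctionSpaces.Torus.convect (fun y => u t y + v t y) (Ψ t) x⟫_ℝ) =
        (∫ x, (⟪u t x, FunctionSpaces.Torus.timeDeriv Ψ t x +
            FunctionSpaces.Torus.convect (b t) (Ψ t) x +
            viscAdjVar (fun y => Visc4.conj ((fun (_ : ℝ) (_ : UnitAddTorus d) => G₀) t y) 𝔸) (Ψ t) x⟫_ℝ +
          A * ⟪b t x, FunctionSpaces.Torus.convect (u t) (Ψ t) x⟫_ℝ)) +
        ∫ x, (⟪v t x, FunctionSpaces.Torus.timeDeriv Ψ t x +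
            FunctionSpaces.Torus.convect (b t) (Ψ t) x +
            viscAdjVar (fun y => Visc4.conj ((fun (_ : ℝ) (_ : UnitAddTorus d) => G₀) t y) 𝔸) (Ψ t) x⟫_ℝ +
          A * ⟪b t x, FunctionSpaces.Torus.convect (v t) (Ψ t) x⟫_ℝ) := by
      filter_upwards [hI₁.prod_right_ae, hI₂.prod_right_ae] with t ht₁ ht₂
      rw [← integral_add ht₁ ht₂]
      exact integral_congr_ae (Eventually.of_forall fun x => hpt t x)
    have hΨ0 : Continuous (Ψ 0) := (hΨ.isSmooth_slice 0).continuous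
    have hd : ∫ x, ⟪u₀ x + v₀ x, Ψ 0 x⟫_ℝ = (∫ x, ⟪u₀ x, Ψ 0 x⟫_ℝ) + ∫ x, ⟪v₀ x, Ψ 0 x⟫_ℝ := by
      simp_rw [inner_add_left]
      exact integral_add (FunctionSpaces.Torus.integrable_inner_of_continuous hu₀ hΨ0)
        (FunctionSpaces.Torus.integrable_inner_of_continuous hv₀ hΨ0)
    rw [integral_congr_ae hslice, integral_add hI₁.integral_prod_left hI₂.integral_prod_left, hd]
    linarith

/-- **Constant multiples of constant-frame distorted weak solutions** are solutions for the multiplied datum.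
[cite: DiPernaLions1989, §II.1 (12)–(14)] [cite: ArmstrongVicol2025, §4.1 (PDF p. 34)] -/
theorem const_smul_constFrame (h₁ : IsWeakTensorPassiveVectorDistortedOn A T 𝔸 b (fun _ _ => G₀) u₀ u) (c : ℝ) :
    IsWeakTensorPassiveVectorDistortedOn A T 𝔸 b (fun _ _ => G₀) (fun x => c • u₀ x) (fun t x => c • u t x) where
  aestronglyMeasurable := h₁.aestronglyMeasurable.const_smul c
  aestronglyMeasurable_carrier := h₁.aestronglyMeasurable_carrier
  ae_lintegral_sq_le := by
    obtain ⟨C, hC⟩ := h₁.ae_lintegral_sq_le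
    refine ⟨‖c‖₊ ^ 2 * C, ?_⟩
    filter_upwards [hC] with t ht
    have e : ∫⁻ x, ‖c • u t x‖ₑ ^ 2 = (‖c‖₊ : ℝ≥0∞) ^ 2 * ∫⁻ x, ‖u t x‖ₑ ^ 2 := by
      rw [← lintegral_const_mul' _ _ (by simp)]
      refine lintegral_congr fun x => ?_
      rw [enorm_smul, mul_pow]
      rfl
    rw [e, ENNReal.coe_mul, ENNReal.coe_pow]
    gcongr
  lintegral_carrier_lt_top := h₁.lintegral_carrier_lt_top
  lintegral_mul_lt_top := by
    have e : ∫⁻ t in Ioo 0 T, ∫⁻ x, ‖b t x‖ₑ * ‖c • u t x‖ₑ =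
        (‖c‖₊ : ℝ≥0∞) * ∫⁻ t in Ioo 0 T, ∫⁻ x, ‖b t x‖ₑ * ‖u t x‖ₑ := by
      rw [← lintegral_const_mul' _ _ (by simp)]
      refine lintegral_congr fun t => ?_
      rw [← lintegral_const_mul' _ _ (by simp)]
      refine lintegral_congr fun x => ?_
      rw [enorm_smul]
      simp only [mul_left_comm]
      rfl
    rw [e]
    exact ENNReal.mul_lt_top (by simp) h₁.lintegral_mul_lt_top
  ae_isWeaklyDivFree_carrier := h₁.ae_isWeaklyDivFree_carrier
  ae_isWeaklyDivFree_distort := by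
    filter_upwards [h₁.ae_isWeaklyDivFree_distort] with t hd₁
    have e : distort ((fun (_ : ℝ) (_ : UnitAddTorus d) => G₀) t) (fun x => c • u t x) =
        fun x => c • distort (fun _ : UnitAddTorus d => G₀) (u t) x := distort_const_smul' G₀ c (u t)
    rw [e]
    exact hd₁.const_smul' c
  weak_eq Ψ hΨ hΨdiv := by
    have e₁ := h₁.weak_eq Ψ hΨ hΨdiv
    have hpt : ∀ t x, ⟪c • u t x, FunctionSpaces.Torus.timeDeriv Ψ t x +
          FunctionSpaces.Torus.convect (b t) (Ψ t) x +
          viscAdjVar (fun y => Visc4.conj ((fun (_ : ℝ) (_ : UnitAddTorus d) => G₀) t y) 𝔸) (Ψ t) x⟫_ℝ +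
        A * ⟪b t x, FunctionSpaces.Torus.convect (fun y => c • u t y) (Ψ t) x⟫_ℝ =
        c * (⟪u t x, FunctionSpaces.Torus.timeDeriv Ψ t x +
            FunctionSpaces.Torus.convect (b t) (Ψ t) x +
            viscAdjVar (fun y => Visc4.conj ((fun (_ : ℝ) (_ : UnitAddTorus d) => G₀) t y) 𝔸) (Ψ t) x⟫_ℝ +
          A * ⟪b t x, FunctionSpaces.Torus.convect (u t) (Ψ t) x⟫_ℝ) := by
      intro t x
      simp only [FunctionSpaces.Torus.convect, map_smul, real_inner_smul_left, real_inner_smul_right]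
      ring
    have hslice : ∀ᵐ t ∂(volume.restrict (Ioo 0 T)),
        ∫ x, (⟪c • u t x, FunctionSpaces.Torus.timeDeriv Ψ t x +
            FunctionSpaces.Torus.convect (b t) (Ψ t) x +
            viscAdjVar (fun y => Visc4.conj ((fun (_ : ℝ) (_ : UnitAddTorus d) => G₀) t y) 𝔸) (Ψ t) x⟫_ℝ +
          A * ⟪b t x, FunctionSpaces.Torus.convect (fun y => c • u t y) (Ψ t) x⟫_ℝ) =
        c * ∫ x, (⟪u t x, FunctionSpaces.Torus.timeDeriv Ψ t x +
            FunctionSpaces.Torus.convect (b t) (Ψ t) x +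
            viscAdjVar (fun y => Visc4.conj ((fun (_ : ℝ) (_ : UnitAddTorus d) => G₀) t y) 𝔸) (Ψ t) x⟫_ℝ +
          A * ⟪b t x, FunctionSpaces.Torus.convect (u t) (Ψ t) x⟫_ℝ) := by
      filter_upwards with t
      rw [← integral_const_mul]
      exact integral_congr_ae (Eventually.of_forall fun x => hpt t x)
    have hd : ∫ x, ⟪c • u₀ x, Ψ 0 x⟫_ℝ = c * ∫ x, ⟪u₀ x, Ψ 0 x⟫_ℝ := by
      simp_rw [real_inner_smul_left]
      exact integral_const_mul _ _
    rw [integral_congr_ae hslice, integral_const_mul, hd, ← mul_add, e₁, mul_zero]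

/-- **Negatives** of constant-frame distorted weak solutions. [cite: DiPernaLions1989, §II.1 (12)–(14)] -/
theorem neg_constFrame (h₁ : IsWeakTensorPassiveVectorDistortedOn A T 𝔸 b (fun _ _ => G₀) u₀ u) :
    IsWeakTensorPassiveVectorDistortedOn A T 𝔸 b (fun _ _ => G₀) (fun x => -u₀ x) (fun t x => -u t x) := by
  have h := h₁.const_smul_constFrame (-1)
  simp only [neg_smul, one_smul] at h
  exact h

/-- **Differences** of constant-frame distorted weak solutions (general integrable data; the equal-data case without
integrability is `sub_of_eq_constFrame`). [cite: DiPernaLions1989, §II.1 (12)–(14)] -/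
theorem sub_constFrame (h₁ : IsWeakTensorPassiveVectorDistortedOn A T 𝔸 b (fun _ _ => G₀) u₀ u)
    (h₂ : IsWeakTensorPassiveVectorDistortedOn A T 𝔸 b (fun _ _ => G₀) v₀ v)
    (hu₀ : Integrable u₀ volume) (hv₀ : Integrable v₀ volume) :
    IsWeakTensorPassiveVectorDistortedOn A T 𝔸 b (fun _ _ => G₀) (fun x => u₀ x - v₀ x) (fun t x => u t x - v t x) := by
  have h := h₁.add_constFrame h₂.neg_constFrame hu₀ hv₀.neg
  simp only [← sub_eq_add_neg] at h
  exact h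

/-- **Finite superposition** of constant-frame distorted weak solutions (non-empty family, integrable data).
[cite: DiPernaLions1989, §II.1 (12)–(14)] [cite: ArmstrongVicol2025, §4.1 (PDF p. 34)] -/
theorem finset_sum_constFrame {ι : Type*} (s : Finset ι) (hs : s.Nonempty)
    {U₀ : ι → UnitAddTorus d → EuclideanSpace ℝ d} {U : ι → ℝ → UnitAddTorus d → EuclideanSpace ℝ d}
    (hint : ∀ i ∈ s, Integrable (U₀ i) volume) (h : ∀ i ∈ s, IsWeakTensorPassiveVectorDistortedOn A T 𝔸 b (fun _ _ => G₀) (U₀ i) (U i)) :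
    IsWeakTensorPassiveVectorDistortedOn A T 𝔸 b (fun _ _ => G₀) (fun x => ∑ i ∈ s, U₀ i x) (fun t x => ∑ i ∈ s, U i t x) := by
  classical
  induction hs using Finset.Nonempty.cons_induction with
  | singleton a =>
    simp only [Finset.sum_singleton]
    exact h a (Finset.mem_singleton_self a)
  | cons a s ha hs ih =>
    simp only [Finset.sum_cons]
    have hint' : ∀ i ∈ s, Integrable (U₀ i) volume := fun i hi => hint i (Finset.mem_cons_of_mem hi)
    have h' : ∀ i ∈ s, IsWeakTensorPassiveVectorDistortedOn A T 𝔸 b (fun _ _ => G₀) (U₀ i) (U i) := fun i hi => h i (Finset.mem_cons_of_mem hi)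
    have hsumint : Integrable (fun x => ∑ i ∈ s, U₀ i x) volume :=
      integrable_finsetSum s fun i hi => hint' i hi
    exact (h a (Finset.mem_cons_self a s)).add_constFrame (ih hint' h') (hint a (Finset.mem_cons_self a s)) hsumint

end IsWeakTensorPassiveVectorDistortedOn

end Torus

end Literature.Analysis.FluidPDE

end
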